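import Summits.HubbardSuperconductivity.HubbardSuperconductivity.Theorems.WeakCouplingBCSKlStairCore
import Literature.MathematicalPhysics.QuantumLattice.KohnLuttingerLindhardMeasurable

/-!
# KL-MARGIN-SCAN reader hubbard-klscan-idea-4 (lens «cascade»), round 10 — TWO-SHELL BOX QUADRATURE:
# kernel FLOORS (and the ceiling architecture) for the static Lindhard function `χ₀(q; μ, t′)` itself
# (crux idea «kernel-lindhard-box» on `stmt-HubbardSuperconductivity-0158`)

WHAT IS NEW (object). Rounds 7–9 certified FREE-BAND GEOMETRY (fillings, van Hove dopings, side words) in the kernel. This file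
lifts the same `decide +kernel` box technology to the LINDHARD FUNCTION `lindhardFunction (squareDispersion 1 t′) μ q` — the one
external input of every KL certificate chain in the tree (`t′ = 0`: the twelve `EnclosuresB1g` HYPOTHESES of
`klb1g_window_d005_d035`; `t′ ≠ 0`: ENGINE-J's float/interval hull table, retracted 2026-08-29 02:39Z) — via the tree's positive
TWO-SHELL FORM `lindhardIntegrand_eq_ite_inv`: the integrand is `1/(|ε_p − μ| + |ε_{p+q} − μ|)` on the crescent
`{occ(p) ≠ occ(p+q)}` and `0` elsewhere (`lindhardIntegrand_le_inv`: `≤ 1/(|ε_p−μ|+|ε_{p+q}−μ|)` everywhere).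

CERTIFICATE (this file, floors). A QUADTREE `QT` over the root square `[−X, X]² ⊂ BZ` (`X ≤ 3.141592`); a leaf `cell` at depth
`d`, position `(i, j)` is the half-open box of side `s = 2X/2^d`. A leaf marked INSIDE-I claims `sup_cell ε_p < μ ≤ inf_cell ε_{p+q}`
(`p` occupied, `p+q` empty), INSIDE-II the mirror claim; both are decided by ONE rational comparison each, because the `t`–`t′` band
`ε = bandQ t′ (cos p₀) (cos p₁)` is ANTITONE in each cosine for `|t′| ≤ 1/2` (r9 `KlStair.bandR_anti_left/right`) and the cosine
RANGE over a rational interval is `[min cosLo endpoints, max cosUp endpoints]` unless the interval may contain a multiple of `π`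
(`mayMin/mayMax`, decided against `piLoQ/piUpQ`). On an inside cell the integrand is `1/g`, `g = |ε_{p+q} − ε_p| > 0` smooth, and
JENSEN + the linear-interpolation remainder give the second-order floor  `∫_cell 1/g ≥ |cell| / (mean of the four corner
enclosures of g + (1+2|t′|)s²)` (`|g_xx|, |g_yy| ≤ 4 + 8|t′|`), all corner data coming from SHARED GRID-POINT RECORDS (`Pt`:
Taylor sums are evaluated once per grid point, never per cell), and ALL per-cell arithmetic is INTEGER fixed-point (denominator `2^40`,
directed rounding), which the kernel runs on GMP. Leaves contribute `⌊2^30 · term⌋ ∈ ℤ` (no rational blow-up); skipped leaves contribute `0`; a node is the sum of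
its four children — so DISJOINTNESS IS STRUCTURAL and an unsound leaf can only be one whose claim the checker rejects (it then
contributes `0`). `QT.eval` is the kernel computation; `FloorSound` is the (named, prover-owned) statement that it is a floor of
`2^30 · ∫_BZ integrand`; `floor_le_lindhard` / `hull_excluded` are its proved consequences, the latter by the BOCHNER DICHOTOMY
(integrable ⇒ `χ₀ ≥ floor/(2π)²`; not integrable ⇒ `χ₀ = 0 <` any positive hull floor) so that NO integrability lemma is needed to
exclude a hull.

SECOND-ORDER BOUNDARY CELLS (the architecture note that makes ceilings and tail widths work; float model `r10/calc/floor3.py`). In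
COSINE COORDINATES `(a, b) = (cos p₀, cos p₁)` the Fermi curve `{ε = μ}` is the EXPLICIT hyperbola `b = b⋆(a) = −(2a + μ)/(2 + 4t′a)`
(`band_affine_in_b`, `band_lt_iff_bStar_lt` below): on a cell straddling ONE Fermi curve the cell integral becomes, after
`dp₁ = db/|sin p₁|`, an explicit `∫ da (1/S(a)) · [log(V + |u|)]`-difference with `|u|` affine in `b` — Jacobian, `S(a) = 2 + 4t′a`
and the far shell `|v| ∈ [V_lo, V_hi]` frozen at cell extremes cost only RELATIVE `O(s)` on the cell's true mass. Cells straddling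
`F − q` are treated in shifted cosine coordinates. Tip cells (both shells straddled) need the one analytic lemma of the line
(uniform-Jacobian change of variables, `∫∫_{[-R,R]²} du dv/(|u|+|v|) = 8R log 2`).

NUMBERS (floats, `r10/calc/*.out`; `μ = −0.9596`, `t′ = −0.3`, the KL-MARGIN-SCAN cell `(⅛, −0.3)`). Point enclosures
`[floor, ceiling]` of `χ₀(q)` with inside (Jensen/chord) + boundary (hyperbola) cells, tips float-estimated:
`q = (−1.22, 1.675)` (the retraction's witness box (E,64,91), withdrawn table hull `[0.2914, 0.3197]`, brute force `0.3326`):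
depth `64·2³`: `[0.3148, 0.3517]`, 12 919 cells · depth `64·2⁵`: `[0.3240, 0.3443]`, 19 381 cells — the FLOOR ALONE exceeds the
withdrawn `hi = 0.3197` from depth `64·2⁴` on (15 847 cells). ENGINE-J tail points (corrected-engine hull widths `0.14–0.25` on the
`|q| ≈ 3.7` backscattering ring `q ≈ 2k_F`, true oscillation over those `0.025`-boxes `0.002–0.02`): widths `0.024–0.055` at
`≈13k` cells, `0.013–0.026` at `≈16–22k`, `0.009–0.015` at `≈20–37k` cells per point. THIS FILE's kernel demo is deliberately small
(inside cells only, coarse depth): it measures the kernel cost per leaf; the production certificate sizes above are for an external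
directed-rounding implementation (margin-1's side) or a tabled fixed-point kernel checker (rung 2).

HONEST FRAMING. Free-band quadrature of `lindhardFunction (squareDispersion 1 t′)` only. Every number quoted above is a FLOAT unless a
`decide +kernel` line below says otherwise; the kernel lines below prove integer identities about `QT.eval`, and the real-analysis
link `FloorSound` is a NAMED HYPOTHESIS here (the provers' item), exactly as `EnclosuresB1g` is in the `t′ = 0` chain. Nothing here
asserts a KL margin at `t′ ≠ 0`, `K₃`, the window or superconductivity; a Kohn–Luttinger `O(U²)` channel statement is not ODLRO;
nothing in this file proves superconductivity in the Hubbard model; no `t′ ≠ 0` statement chains to the summit Statement.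
-/

noncomputable section

set_option linter.dupNamespace false

namespace Summit.HubbardSuperconductivity.HubbardSuperconductivity.Theorems.KlLindhardBox

open Real Set MeasureTheory Literature.MathematicalPhysics.QuantumLattice
open Summit.HubbardSuperconductivity.HubbardSuperconductivity.Theorems
open Summit.HubbardSuperconductivity.HubbardSuperconductivity.Theorems.FSPoly (cosTaylorQ cosLoQ cosUpQ piLoQ cosLoQ_le_cos
  cos_le_cosUpQ cast_cosTaylorQ)
open Summit.HubbardSuperconductivity.HubbardSuperconductivity.Theorems.KlStair (bandQ bandR piUpQ cast_bandQ
  squareDispersion_eq_bandR pi_lt_piUpQ)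

/-! ## §1 Rational enclosures of `cos` (all real arguments; orders chosen for `|x| ≤ π` resp. `|x| ≤ π + |q| < 5`) -/

/-- Degree-18 Taylor MINORANT of `cos` (odd `M = 9`), used at the shifted abscissae `p + q`. [folklore] -/
def cosLo9 (x : ℚ) : ℚ := cosTaylorQ 9 x

/-- Degree-20 Taylor MAJORANT of `cos` (even `M = 10`), used at the shifted abscissae `p + q`. [folklore] -/
def cosUp10 (x : ℚ) : ℚ := cosTaylorQ 10 x

/-- `cosLo9 x ≤ cos x` for every rational `x`. [folklore] -/
theorem cosLo9_le_cos (x : ℚ) : ((cosLo9 x : ℚ) : ℝ) ≤ Real.cos (x : ℝ) := by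
  rw [cosLo9, cast_cosTaylorQ]
  exact Literature.Computability.MetaComplexity.cosTaylorSum_le_cos (M := 9) (by decide) _

/-- `cos x ≤ cosUp10 x` for every rational `x`. [folklore] -/
theorem cos_le_cosUp10 (x : ℚ) : Real.cos (x : ℝ) ≤ ((cosUp10 x : ℚ) : ℝ) := by
  rw [cosUp10, cast_cosTaylorQ]
  exact Literature.Computability.MetaComplexity.cos_le_cosTaylorSum (M := 10) (by decide) _

/-- Directed rounding DOWN to the dyadic grid `2^-40` (keeps every downstream rational small; `dn x ≤ x`). [folklore] -/
def dn (x : ℚ) : ℚ := ((Rat.floor (x * 2 ^ 40) : ℤ) : ℚ) / 2 ^ 40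

/-- Directed rounding UP to the dyadic grid `2^-40` (`x ≤ up x`). [folklore] -/
def up (x : ℚ) : ℚ := -dn (-x)

/-- `dn x ≤ x`. [folklore] -/
theorem dn_le (x : ℚ) : dn x ≤ x := by
  unfold dn
  rw [div_le_iff₀ (by positivity)]
  exact Rat.floor_le _

/-- `x ≤ up x`. [folklore] -/
theorem le_up (x : ℚ) : x ≤ up x := by
  unfold up; have := dn_le (-x); linarith

/-- Rounded-down `T₇` cosine minorant (arguments `|x| ≤ π`). [folklore] -/
def cLo (x : ℚ) : ℚ := dn (cosLoQ x)
/-- Rounded-up `T₈` cosine majorant (arguments `|x| ≤ π`). [folklore] -/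
def cUp (x : ℚ) : ℚ := up (cosUpQ x)
/-- Rounded-down `T₉` cosine minorant (shifted arguments, `|x| < 2π`). [folklore] -/
def cLo' (x : ℚ) : ℚ := dn (cosLo9 x)
/-- Rounded-up `T₁₀` cosine majorant (shifted arguments, `|x| < 2π`). [folklore] -/
def cUp' (x : ℚ) : ℚ := up (cosUp10 x)

/-- `cLo x ≤ cos x`. [folklore] -/
theorem cLo_le_cos (x : ℚ) : ((cLo x : ℚ) : ℝ) ≤ Real.cos (x : ℝ) :=
  le_trans (by exact_mod_cast dn_le _) (cosLoQ_le_cos x)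
/-- `cos x ≤ cUp x`. [folklore] -/
theorem cos_le_cUp (x : ℚ) : Real.cos (x : ℝ) ≤ ((cUp x : ℚ) : ℝ) :=
  le_trans (cos_le_cosUpQ x) (by exact_mod_cast le_up _)
/-- `cLo' x ≤ cos x`. [folklore] -/
theorem cLo'_le_cos (x : ℚ) : ((cLo' x : ℚ) : ℝ) ≤ Real.cos (x : ℝ) :=
  le_trans (by exact_mod_cast dn_le _) (cosLo9_le_cos x)
/-- `cos x ≤ cUp' x`. [folklore] -/
theorem cos_le_cUp' (x : ℚ) : Real.cos (x : ℝ) ≤ ((cUp' x : ℚ) : ℝ) :=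
  le_trans (cos_le_cosUp10 x) (by exact_mod_cast le_up _)

/-! ### §1b Fixed-point conventions
All kernel-side arithmetic below is INTEGER arithmetic (GMP-accelerated in the kernel): abscissae are integers in units `u = 1/2 000 000`
(so `π` is enclosed by `PILO = 6 283 184 < 2 000 000·π < PIUPZ = 6 283 186`), and every cosine / band value is an integer numerator over the
fixed denominator `D = 2^40`, rounded ONCE in the safe direction (`flZ` down, `clZ` up). Rationals (`ℚ`) appear only in the grid-point records'
construction (one Taylor sum per record field) and on the real-analysis side. -/

/-- The fixed denominator `D = 2^40` of all value numerators. [folklore] -/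
def D : ℤ := 2 ^ 40

/-- Grid unit denominator: abscissae are `z / U`. [folklore] -/
def U : ℤ := 2000000

/-- `⌊2 000 000 · piLoQ⌋ = 6 283 184 < 2 000 000 π`. [folklore] -/
def PILOZ : ℤ := 6283184

/-- `6 283 186 = 2 000 000 · piUpQ > 2 000 000 π`. [folklore] -/
def PIUPZ : ℤ := 6283186

/-- Integer grid coordinate ↦ rational coordinate. [folklore] -/
def toQ (z : ℤ) : ℚ := (z : ℚ) / 2000000

/-- Round a rational DOWN to an integer numerator over `D`: `flZ x / D ≤ x`. [folklore] -/
def flZ (x : ℚ) : ℤ := Rat.floor (x * 2 ^ 40)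

/-- Round a rational UP to an integer numerator over `D`: `x ≤ clZ x / D`. [folklore] -/
def clZ (x : ℚ) : ℤ := -Rat.floor (-x * 2 ^ 40)

/-- `flZ x / D ≤ x`. [folklore] -/
theorem flZ_le (x : ℚ) : ((flZ x : ℤ) : ℚ) / 2 ^ 40 ≤ x := by
  unfold flZ
  rw [div_le_iff₀ (by positivity)]
  exact Rat.floor_le _

/-- `x ≤ clZ x / D`. [folklore] -/
theorem le_clZ (x : ℚ) : x ≤ ((clZ x : ℤ) : ℚ) / 2 ^ 40 := by
  unfold clZ
  rw [le_div_iff₀ (by positivity)]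
  have := Rat.floor_le (-x * 2 ^ 40)
  push_cast; linarith

/-- Floor division by a POSITIVE integer (`Int` division `/` is Euclidean, = floor for positive divisors). [folklore] -/
def fdivZ (a b : ℤ) : ℤ := a / b

/-- Ceiling division by a positive integer. [folklore] -/
def cdivZ (a b : ℤ) : ℤ := -((-a) / b)

/-- May the integer abscissa interval `[u0, u1]` (units `1/U`, `|u0|, |u1| < 3π·U`) contain an ODD multiple of `π` (a minimiser of `cos`)?
Decided conservatively against `PILOZ < πU < PIUPZ`. [folklore] -/
def mayMinZ (u0 u1 : ℤ) : Bool :=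
  (decide (u0 < PIUPZ) && decide (PILOZ < u1)) || (decide (u0 < -PILOZ) && decide (-PIUPZ < u1)) ||
    decide (3 * PILOZ ≤ u1) || decide (u0 ≤ -(3 * PILOZ))

/-- May `[u0, u1]` (with `|u0|, |u1| < 4π·U`) contain an EVEN multiple of `π` (a maximiser of `cos`)? [folklore] -/
def mayMaxZ (u0 u1 : ℤ) : Bool :=
  (decide (u0 ≤ 0) && decide (0 ≤ u1)) || (decide (u0 < 2 * PIUPZ) && decide (2 * PILOZ < u1)) ||
    (decide (u0 < -(2 * PILOZ)) && decide (-(2 * PIUPZ) < u1))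

/-- Lower bound (numerator over `D`) of `cos` on `[u0, u1]/U` from minorant numerators `l0, l1` at the endpoints: `−D` if a minimiser may lie
inside, else the smaller endpoint value (between consecutive minimisers `cos` is quasiconcave). [folklore] -/
def cosInfZ (u0 u1 l0 l1 : ℤ) : ℤ := if mayMinZ u0 u1 then -D else min l0 l1

/-- Upper bound (numerator over `D`) of `cos` on `[u0, u1]/U` from majorant numerators at the endpoints. [folklore] -/
def cosSupZ (u0 u1 h0 h1 : ℤ) : ℤ := if mayMaxZ u0 u1 then D else max h0 h1

/-- Is `cos` certified MONOTONE on `[u0, u1]/U`? `some true` = decreasing (`[0, π]` or `[−2π, −π]`), `some false` = increasing. [folklore] -/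
def cosDirZ (u0 u1 : ℤ) : Option Bool :=
  if (decide (0 ≤ u0) && decide (u1 ≤ PILOZ)) || decide (u1 ≤ -PIUPZ) then some true
  else if (decide (-PILOZ ≤ u0) && decide (u1 ≤ 0)) || decide (PIUPZ ≤ u0) then some false
  else none

/-- INNER enclosure `[c0, c1]/D ⊆ cos '' [u0, u1]/U` when `cos` is certified monotone there, from the endpoint minorant/majorant numerators
(`l0 ≤ D cos(u0/U) ≤ h0`, …). [folklore] -/
def cosInnerZ (u0 u1 l0 h0 l1 h1 : ℤ) : Option (ℤ × ℤ) :=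
  match cosDirZ u0 u1 with
  | some true => some (h1, l0)
  | some false => some (h0, l1)
  | none => none

/-- Lower bound (over `D`) of `|cos|` on an interval from an OUTER range `[lo, hi]/D`. [folklore] -/
def absLoZ (lo hi : ℤ) : ℤ := if lo ≤ 0 ∧ 0 ≤ hi then 0 else min |lo| |hi|

/-! ## §2 Parameters, grid-point records, and the per-cell Jensen floor (fixed point) -/

/-- Certificate parameters: band `t′ = tpN/tpD`, chemical potential `μ = muN/muD`, transfer momentum `q = (q1z, q2z)/U` (grid units), root
half-width `Xz/U` (root square `[−X, X]²`; a FLOOR certificate needs `X ≤ piLoQ`). [folklore] -/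
structure Params where
  /-- numerator of `t′` -/
  tpN : ℤ
  /-- denominator of `t′` (positive) -/
  tpD : ℤ
  /-- numerator of `μ` -/
  muN : ℤ
  /-- denominator of `μ` (positive) -/
  muD : ℤ
  /-- transfer momentum, first coordinate, in units `1/U` -/
  q1z : ℤ
  /-- transfer momentum, second coordinate, in units `1/U` -/
  q2z : ℤ
  /-- half-width of the root square in units `1/U` (a multiple of `2^11`, so every grid point down to depth 11 is integral) -/
  Xz : ℤ

/-- `t′` as a rational. [folklore] -/
def Params.tp (P : Params) : ℚ := (P.tpN : ℚ) / (P.tpD : ℚ)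
/-- `μ` as a rational. [folklore] -/
def Params.mu (P : Params) : ℚ := (P.muN : ℚ) / (P.muD : ℚ)
/-- `q₁` as a rational. [folklore] -/
def Params.q1 (P : Params) : ℚ := toQ P.q1z
/-- `q₂` as a rational. [folklore] -/
def Params.q2 (P : Params) : ℚ := toQ P.q2z
/-- Half-width of the root square as a rational. [folklore] -/
def Params.X (P : Params) : ℚ := toQ P.Xz

/-- GRID-POINT RECORD for an abscissa `x = u/U`: integer numerators over `D` of the four cosine enclosures every cell with this corner needs
(`cos x` from below/above, `cos (x + q₁)` from below/above). Built ONCE per grid point by `QT.eval` and shared by all descendant cells: the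
Taylor sums are evaluated per grid point, never per cell. [folklore] -/
structure Pt where
  /-- grid coordinate (units `1/U`) -/
  z : ℤ
  /-- `≤ D cos x` -/
  lo : ℤ
  /-- `≥ D cos x` -/
  hi : ℤ
  /-- `≤ D cos (x + q)` -/
  lo' : ℤ
  /-- `≥ D cos (x + q)` -/
  hi' : ℤ

/-- Build the abscissa record at grid coordinate `z` (shift `q₁`; unshifted sums `T₇/T₈`, shifted `T₉/T₁₀`). [folklore] -/
def Params.mkX (P : Params) (z : ℤ) : Pt :=
  ⟨z, flZ (cosLoQ (toQ z)), clZ (cosUpQ (toQ z)), flZ (cosLo9 (toQ (z + P.q1z))), clZ (cosUp10 (toQ (z + P.q1z)))⟩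

/-- Build the ordinate record at grid coordinate `z` (shift `q₂`). [folklore] -/
def Params.mkY (P : Params) (z : ℤ) : Pt :=
  ⟨z, flZ (cosLoQ (toQ z)), clZ (cosUpQ (toQ z)), flZ (cosLo9 (toQ (z + P.q2z))), clZ (cosUp10 (toQ (z + P.q2z)))⟩

/-- Projection computation rule used when assembling split certificates. [folklore] -/
theorem Params.mkX_z (P : Params) (z : ℤ) : (P.mkX z).z = z := rfl

/-- Projection computation rule used when assembling split certificates. [folklore] -/
theorem Params.mkY_z (P : Params) (z : ℤ) : (P.mkY z).z = z := rfl

/-- Monotonicity guard for an enclosure numerator `c`: `−2 < 4 t′ c/D`, i.e. `∂ bandQ/∂(other argument) = −2 − 4t′c < 0`. [folklore] -/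
def Params.guard (P : Params) (c : ℤ) : Bool := decide (-2 * D * P.tpD < 4 * P.tpN * c)

/-- UPPER integer enclosure (over `D`) of the band `−2(a+b) − 4t′ab` at value numerators `a, b`: the `t′`-term is floor-divided. [folklore] -/
def Params.bandUpZ (P : Params) (a b : ℤ) : ℤ := -2 * (a + b) - fdivZ (4 * P.tpN * a * b) (P.tpD * D)

/-- LOWER integer enclosure (over `D`) of the band at value numerators `a, b`. [folklore] -/
def Params.bandDnZ (P : Params) (a b : ℤ) : ℤ := -2 * (a + b) - cdivZ (4 * P.tpN * a * b) (P.tpD * D)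

/-- `v/D < μ` for an integer numerator `v`. [folklore] -/
def Params.ltMu (P : Params) (v : ℤ) : Bool := decide (v * P.muD < P.muN * D)

/-- `μ ≤ v/D`. [folklore] -/
def Params.muLe (P : Params) (v : ℤ) : Bool := decide (P.muN * D ≤ v * P.muD)

/-- `⌊D μ⌋`. [folklore] -/
def Params.muFl (P : Params) : ℤ := fdivZ (P.muN * D) P.muD

/-- `⌈D μ⌉`. [folklore] -/
def Params.muCl (P : Params) : ℤ := cdivZ (P.muN * D) P.muD

/-- Outer range data of a cell `[x0, x1] × [y0, y1]`: `(aLo, aUp, bLo, bUp, aLo', aUp', bLo', bUp')` = integer enclosures (over `D`) of the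
ranges of `cos p₀`, `cos p₁`, `cos (p₀ + q₁)`, `cos (p₁ + q₂)` over the cell, from the corner records. [folklore] -/
def Params.ranges (P : Params) (x0 x1 y0 y1 : Pt) : ℤ × ℤ × ℤ × ℤ × ℤ × ℤ × ℤ × ℤ :=
  (cosInfZ x0.z x1.z x0.lo x1.lo, cosSupZ x0.z x1.z x0.hi x1.hi, cosInfZ y0.z y1.z y0.lo y1.lo, cosSupZ y0.z y1.z y0.hi y1.hi,
    cosInfZ (x0.z + P.q1z) (x1.z + P.q1z) x0.lo' x1.lo', cosSupZ (x0.z + P.q1z) (x1.z + P.q1z) x0.hi' x1.hi',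
    cosInfZ (y0.z + P.q2z) (y1.z + P.q2z) y0.lo' y1.lo', cosSupZ (y0.z + P.q2z) (y1.z + P.q2z) y0.hi' y1.hi')

/-- Upper enclosure (over `D`) of `g = |ε_{p+q} − ε_p|` at a CORNER from its records, for kind `k` (`k = true`: `g = ε_{p+q} − ε_p`). [folklore] -/
def Params.gCorner (P : Params) (k : Bool) (x y : Pt) : ℤ :=
  if k then P.bandUpZ x.lo' y.lo' - P.bandDnZ x.hi y.hi else P.bandUpZ x.lo y.lo - P.bandDnZ x.hi' y.hi'

/-- The Jensen FLOOR TERM (units `2^-30`) of the cell `[x0, x1] × [y0, y1]` claimed INSIDE of kind `k` (`k = true`: `p` occupied and `p + q`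
empty on the cell; `k = false`: the mirror), or `0` if the claim is not certified. On an inside cell the integrand is `1/g` with `g > 0`
smooth; JENSEN gives `∫_cell 1/g ≥ |cell|/avg(g)` and `avg(g) ≤ mean of the four corner values + (s²/12)(‖g_xx‖ + ‖g_yy‖) ≤ meanU +
(2/3)(1 + 2|t′|)s²` (cell-averaged bilinear-interpolation error, `|g_xx|, |g_yy| ≤ 4 + 8|t′|`). With `SUM4 =` the four corner numerators and
`E ≥ 4D·(2/3)(1+2|t′|)s²` the term is `⌊2^32 D (Δz)² / (U² (SUM4 + E))⌋ ≤ 2^30 s²/(meanU + …)`. The eight `guard`s certify that the band is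
antitone in each cosine argument between the true cosine and its enclosure. [folklore] -/
def Params.leafTerm (P : Params) (k : Bool) (x0 x1 y0 y1 : Pt) : ℤ :=
  let dz := x1.z - x0.z
  match P.ranges x0 x1 y0 y1 with
  | (aLo, aUp, bLo, bUp, aLo', aUp', bLo', bUp') =>
    let guards := P.guard aLo && P.guard aUp && P.guard bLo && P.guard bUp && P.guard aLo' && P.guard aUp' && P.guard bLo' &&
      P.guard bUp'
    let inside := if k then P.ltMu (P.bandUpZ aLo bLo) && P.muLe (P.bandDnZ aUp' bUp')
      else P.ltMu (P.bandUpZ aLo' bLo') && P.muLe (P.bandDnZ aUp bUp)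
    let sum4 := P.gCorner k x0 y0 + P.gCorner k x1 y0 + P.gCorner k x0 y1 + P.gCorner k x1 y1
    -- E ≥ 4·D·(2/3)(1 + 2|t′|)·(dz/U)² :  ⌈8 D (tpD + 2|tpN|) dz² / (3 tpD U²)⌉
    let e := cdivZ (8 * D * (P.tpD + 2 * |P.tpN|) * dz ^ 2) (3 * P.tpD * U ^ 2)
    let den := sum4 + e
    if guards && inside && decide (0 < den) && decide (y1.z - y0.z = dz) && decide (0 < dz) then
      fdivZ (2 ^ 32 * D * dz ^ 2) (U ^ 2 * den) else 0

end Summit.HubbardSuperconductivity.HubbardSuperconductivity.Theorems.KlLindhardBox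

end
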